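import Summits.Ventures.GridStability.Models.LossySymmetrizerSpectrum

/-!
# GridStability/Models/LossyNumericalRangeSpectrum — the ROBUST lossy lane: numerical-range certificates for `M⁻¹L(δ)` (real part from the symmetric part, imaginary part from the skew part) and the complex mode equation

Cell `gridfusion` (LADDER-GRIDFUSION, APEX LINE «inverter-dominated networks», rung G3 / row family «G3-ss»;
seat gridfusion-model-3 (g6)). Sequel of `Models/LossySymmetrizerSpectrum.lean` (p505445: EXACT symmetrizer
`S A = AᵀS`, real spectrum, `Re z = −d/2` exactly). The exact symmetrizer has two limits named there as
CEILING: (i) its rational heights grow like `n²` data heights (fine at `n = 3`, unwieldy at `n = 10`);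
(ii) a heavily resistive network may have genuinely COMPLEX pencil eigenvalues `ν = a + ib`, and then no
symmetrizer exists at all. This file removes both with the numerical-range form of the same idea — ANY
positive definite `S` (a rounded float near-symmetrizer will do, small heights), no exact linear constraint:
* §0 ([folklore], any `n`) `re_eig_gt_of_numRange`: `S ≻ 0`, `wᵀA = 0`,
  `S A + (S A)ᵀ − 2ν₀·S + β·w wᵀ ≻ 0` ⇒ every complex eigenpair `A x = μ x`, `x ≠ 0`, has `μ = 0` or
  `Re μ > ν₀` (`Re(x*SAx) = Re μ · x*Sx`, and `x*Nᵀx = conj(x*Nx)` for real `N`);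
  `im_eig_le_of_numRange`: `S ≻ 0`, `K = S A − (S A)ᵀ` (twice the skew part) and the `2n × 2n` real
  symmetric matrix `[[2κ·S, K], [Kᵀ, 2κ·S]] ⪰ 0` ⇒ `|Im μ| ≤ κ` (test vector `[x; ±i·x]`);
  `quadratic_re_lt_neg_of_region`: the COMPLEX mode equation `z² + d z + ν = 0` (`d` real) has both roots in
  `Re z < −r` as soon as `d > 2r` and `(d − 2r)²·(Re ν + r² − d r) > (Im ν)²` (Routh–Hurwitz for a complex
  constant term; at `r = 0`: `d²·Re ν > (Im ν)²` — the parabolic region that replaces «`ν` real `> 0`»).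
* The model-side wrappers (`ClassicalSwing.eig_re_lt_neg_of_numRange`: the three certificates + `d > 2r` +
  `κ² ≤ (d − 2r)²·(ν₀ + r² − d r)` ⇒ `Re z < −r` off the synchronous mode; `PeJac_ker_const_of_numRange`;
  the droop reading) live in the sequel `Models/LossyNumericalRangeSwing.lean` (400-line rule).
COST per instance: PSD checks of sizes `n`, `n`, `2n` (integer Gram route, lit-5) + one vector identity; the
only exact high object left is the left null vector `w` (rational, `n`·data-height). When `S` happens to be
an exact symmetrizer, `K = 0`, `κ = 0` and §1 reduces to p505445's rate form. VALIDATED input only: the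
float near-symmetrizer; everything the kernel sees is exact.
THREE COLUMNS. CERTIFIED (kernel, once instantiated): statements about the MATRIX `J(δ)`; nothing about
the nonlinear flow. MODELLED: classical model WITH transfer conductances MV-2 + MV-λ
[cite: SauerPai1998, §6.10]; droop reading MV-6N [cite: KunduEtAl2019, eqs. (4a)–(4b), (5a)]
[cite: SchifferEtAl2014, Remark 3.3]; mode equation [cite: HairerNorsettWanner1993, §I.13 Theorem 13.4].
No parameter values. No sentence of this file says a converter, a microgrid or a grid is stable.
-/

noncomputable section

open Real Matrix Finset
open scoped ComplexOrder ComplexConjugate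

namespace Summit.Ventures.GridStability.Models

/-! ## §0 Linear algebra: numerical-range certificates -/

section NumRange

variable {ι : Type*} [Fintype ι] [DecidableEq ι]

omit [DecidableEq ι] in
/-- For a REAL matrix `N` and a complex vector `x`: `x*Nᵀx = conj(x*Nx)`. [folklore] -/
theorem star_dotProduct_transpose_map_mulVec (N : Matrix ι ι ℝ) (x : ι → ℂ) :
    star x ⬝ᵥ (Nᵀ.map ((↑) : ℝ → ℂ) *ᵥ x) = conj (star x ⬝ᵥ (N.map ((↑) : ℝ → ℂ) *ᵥ x)) := by
  simp only [dotProduct, map_ofReal_mulVec_apply, Matrix.transpose_apply, Pi.star_apply, map_sum, map_mul,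
    Complex.star_def, Complex.conj_conj, Complex.conj_ofReal, Finset.mul_sum]
  rw [Finset.sum_comm]
  refine Finset.sum_congr rfl fun i _ => Finset.sum_congr rfl fun j _ => ?_
  ring

/-- The Hermitian form of a real positive SEMIdefinite matrix is nonnegative on complex vectors (plumbing).
[folklore] -/
theorem dotProduct_map_ofReal_mulVec_nonneg {B : Matrix ι ι ℝ} (hB : B.PosSemidef) (y : ι → ℂ) :
    0 ≤ star y ⬝ᵥ (B.map ((↑) : ℝ → ℂ) *ᵥ y) := by
  have hsd : (B.map Complex.ofRealHom).PosSemidef := by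
    open scoped MatrixOrder in
    obtain ⟨R, hR⟩ := CStarAlgebra.nonneg_iff_eq_star_mul_self.mp hB.nonneg
    rw [hR, Matrix.star_eq_conjTranspose, Matrix.map_mul,
      Matrix.conjTranspose_map _ (fun a => by simp)]
    exact Matrix.posSemidef_conjTranspose_mul_self _
  exact hsd.dotProduct_mulVec_nonneg y

omit [DecidableEq ι] in
/-- At an eigenvector, `x*(S A)x = μ · x*Sx` (plumbing shared by the two certificates). [folklore] -/
theorem star_dotProduct_mul_map_mulVec_of_eig {A S : Matrix ι ι ℝ} {μ : ℂ} {x : ι → ℂ}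
    (hAx : A.map ((↑) : ℝ → ℂ) *ᵥ x = μ • x) :
    star x ⬝ᵥ ((S * A).map ((↑) : ℝ → ℂ) *ᵥ x) = μ * (star x ⬝ᵥ (S.map ((↑) : ℝ → ℂ) *ᵥ x)) := by
  have hAxi : ∀ i, (A.map ((↑) : ℝ → ℂ) *ᵥ x) i = μ * x i := fun i => by
    simpa using congr_fun hAx i
  have hSA : ∀ i, ((S * A).map ((↑) : ℝ → ℂ) *ᵥ x) i = μ * (S.map ((↑) : ℝ → ℂ) *ᵥ x) i := by
    intro i
    rw [map_ofReal_mul_mulVec_apply, map_ofReal_mulVec_apply, Finset.mul_sum]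
    refine Finset.sum_congr rfl fun k _ => ?_
    rw [hAxi]
    ring
  simp only [dotProduct, Pi.star_apply, hSA, Finset.mul_sum]
  refine Finset.sum_congr rfl fun i _ => ?_
  ring

/-- **Real part of the spectrum from the SYMMETRIC PART (any `n`, any positive definite `S`).** `A`, `S`
real, `S ≻ 0`, `wᵀA = 0`, and `S A + (S A)ᵀ − 2ν₀·S + β·w wᵀ ≻ 0` ⇒ every complex solution of `A x = μ x`,
`x ≠ 0`, has `μ = 0` or `Re μ > ν₀`. (`S` need NOT symmetrize `A`.) [folklore] -/
theorem re_eig_gt_of_numRange {A S : Matrix ι ι ℝ} {w : ι → ℝ} (hS : S.PosDef)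
    (hw : Matrix.vecMul w A = 0) {ν₀ β : ℝ}
    (hH : (S * A + (S * A)ᵀ - (2 * ν₀) • S + β • Matrix.vecMulVec w w).PosDef)
    {μ : ℂ} {x : ι → ℂ} (hx : x ≠ 0) (hAx : A.map ((↑) : ℝ → ℂ) *ᵥ x = μ • x) :
    μ = 0 ∨ ν₀ < μ.re := by
  by_cases hμ0 : μ = 0
  · exact Or.inl hμ0
  right
  have hwA : ∀ j, ∑ i, w i * A i j = 0 := fun j => by
    have := congr_fun hw j
    simpa [Matrix.vecMul, dotProduct] using this
  have hAxi : ∀ i, (A.map ((↑) : ℝ → ℂ) *ᵥ x) i = μ * x i := fun i => by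
    simpa using congr_fun hAx i
  -- the left null vector annihilates the eigenvector
  have hsum : ∑ i, (w i : ℂ) * x i = 0 := by
    have h1 : ∑ i, (w i : ℂ) * (A.map ((↑) : ℝ → ℂ) *ᵥ x) i = 0 := by
      simp_rw [map_ofReal_mulVec_apply, Finset.mul_sum]
      rw [Finset.sum_comm]
      refine Finset.sum_eq_zero fun j _ => ?_
      have : ∑ i, (w i : ℂ) * ((A i j : ℂ) * x j) = (∑ i, ((w i * A i j : ℝ) : ℂ)) * x j := by
        rw [Finset.sum_mul]
        refine Finset.sum_congr rfl fun i _ => ?_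
        push_cast
        ring
      rw [this]
      have h0 : (∑ i, ((w i * A i j : ℝ) : ℂ)) = 0 := by exact_mod_cast hwA j
      rw [h0, zero_mul]
    simp_rw [hAxi] at h1
    have h2 : μ * ∑ i, (w i : ℂ) * x i = 0 := by
      rw [Finset.mul_sum, ← h1]
      refine Finset.sum_congr rfl fun i _ => ?_
      ring
    rcases mul_eq_zero.1 h2 with h | h
    · exact absurd h hμ0
    · exact h
  -- the rank-one term vanishes on x
  have hW : star x ⬝ᵥ ((Matrix.vecMulVec w w).map ((↑) : ℝ → ℂ) *ᵥ x) = 0 := by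
    have hWi : ∀ i, ((Matrix.vecMulVec w w).map ((↑) : ℝ → ℂ) *ᵥ x) i = 0 := by
      intro i
      rw [map_ofReal_mulVec_apply]
      have : ∑ j, ((Matrix.vecMulVec w w i j : ℝ) : ℂ) * x j = (w i : ℂ) * ∑ j, (w j : ℂ) * x j := by
        rw [Finset.mul_sum]
        refine Finset.sum_congr rfl fun j _ => ?_
        simp only [Matrix.vecMulVec_apply]
        push_cast
        ring
      rw [this, hsum, mul_zero]
    simp [dotProduct, hWi]
  -- the forms
  set q : ℂ := star x ⬝ᵥ (S.map ((↑) : ℝ → ℂ) *ᵥ x) with hqdef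
  have hp : 0 < q := dotProduct_map_ofReal_mulVec_pos hS hx
  have hN : star x ⬝ᵥ ((S * A).map ((↑) : ℝ → ℂ) *ᵥ x) = μ * q :=
    star_dotProduct_mul_map_mulVec_of_eig hAx
  have hNT : star x ⬝ᵥ ((S * A)ᵀ.map ((↑) : ℝ → ℂ) *ᵥ x) = conj μ * q := by
    rw [star_dotProduct_transpose_map_mulVec, hN, map_mul]
    obtain ⟨-, hqim⟩ := Complex.pos_iff.1 hp
    congr 1
    exact Complex.ext (by simp) (by simp [← hqim])
  set H : Matrix ι ι ℝ := S * A + (S * A)ᵀ - (2 * ν₀) • S + β • Matrix.vecMulVec w w with hHdef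
  have hsplit : H.map ((↑) : ℝ → ℂ) = (S * A).map ((↑) : ℝ → ℂ) + (S * A)ᵀ.map ((↑) : ℝ → ℂ)
      - ((2 * ν₀ : ℝ) : ℂ) • S.map ((↑) : ℝ → ℂ) + (β : ℂ) • (Matrix.vecMulVec w w).map ((↑) : ℝ → ℂ) := by
    ext a b
    simp [hHdef, Matrix.add_apply, Matrix.sub_apply, Matrix.smul_apply]
  have hform : star x ⬝ᵥ (H.map ((↑) : ℝ → ℂ) *ᵥ x) = (μ + conj μ - ((2 * ν₀ : ℝ) : ℂ)) * q := by
    rw [hsplit, Matrix.add_mulVec, Matrix.sub_mulVec, Matrix.add_mulVec, Matrix.smul_mulVec,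
      Matrix.smul_mulVec, dotProduct_add, dotProduct_sub, dotProduct_add, dotProduct_smul, dotProduct_smul,
      hN, hNT, hW, smul_eq_mul, smul_eq_mul, mul_zero, add_zero, hqdef]
    ring
  have hpos : 0 < star x ⬝ᵥ (H.map ((↑) : ℝ → ℂ) *ᵥ x) := dotProduct_map_ofReal_mulVec_pos hH hx
  rw [hform] at hpos
  -- real arithmetic
  obtain ⟨hqre, hqim⟩ := Complex.pos_iff.1 hp
  have hcoef : μ + conj μ - ((2 * ν₀ : ℝ) : ℂ) = ((2 * μ.re - 2 * ν₀ : ℝ) : ℂ) := by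
    refine Complex.ext ?_ ?_
    · simp; ring
    · simp
  rw [hcoef] at hpos
  have hqC : q = (q.re : ℂ) := Complex.ext (by simp) (by simp [← hqim])
  rw [hqC, ← Complex.ofReal_mul] at hpos
  have h := Complex.zero_lt_real.1 hpos
  nlinarith [hqre]

/-- **Imaginary part of the spectrum from the SKEW PART (any `n`).** `S ≻ 0`, `K = S A − (S A)ᵀ`, and
the real symmetric `2n × 2n` matrix `[[2κ·S, K], [Kᵀ, 2κ·S]]` positive semidefinite ⇒ every complex solution
of `A x = μ x`, `x ≠ 0`, has `|Im μ| ≤ κ` (test vectors `[x; i x]` and `[x; −i x]`). [folklore] -/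
theorem im_eig_le_of_numRange {A S K : Matrix ι ι ℝ} (hS : S.PosDef) (hK : K = S * A - (S * A)ᵀ)
    {κ : ℝ} (hB : (Matrix.fromBlocks ((2 * κ) • S) K Kᵀ ((2 * κ) • S)).PosSemidef)
    {μ : ℂ} {x : ι → ℂ} (hx : x ≠ 0) (hAx : A.map ((↑) : ℝ → ℂ) *ᵥ x = μ • x) :
    |μ.im| ≤ κ := by
  set q : ℂ := star x ⬝ᵥ (S.map ((↑) : ℝ → ℂ) *ᵥ x) with hqdef
  have hp : 0 < q := dotProduct_map_ofReal_mulVec_pos hS hx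
  obtain ⟨hqre, hqim⟩ := Complex.pos_iff.1 hp
  have hN : star x ⬝ᵥ ((S * A).map ((↑) : ℝ → ℂ) *ᵥ x) = μ * q :=
    star_dotProduct_mul_map_mulVec_of_eig hAx
  have hNT : star x ⬝ᵥ ((S * A)ᵀ.map ((↑) : ℝ → ℂ) *ᵥ x) = conj μ * q := by
    rw [star_dotProduct_transpose_map_mulVec, hN, map_mul]
    congr 1
    exact Complex.ext (by simp) (by simp [← hqim])
  -- the forms of K and Kᵀ at x
  have hKx : star x ⬝ᵥ (K.map ((↑) : ℝ → ℂ) *ᵥ x) = (μ - conj μ) * q := by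
    have : K.map ((↑) : ℝ → ℂ) = (S * A).map ((↑) : ℝ → ℂ) - (S * A)ᵀ.map ((↑) : ℝ → ℂ) := by
      ext a b; simp [hK]
    rw [this, Matrix.sub_mulVec, dotProduct_sub, hN, hNT]
    ring
  have hKTx : star x ⬝ᵥ (Kᵀ.map ((↑) : ℝ → ℂ) *ᵥ x) = (conj μ - μ) * q := by
    rw [star_dotProduct_transpose_map_mulVec, hKx, map_mul, map_sub, Complex.conj_conj]
    congr 1
    exact Complex.ext (by simp) (by simp [← hqim])
  -- test vector [x; c x] for a unit scalar c ∈ {i, −i}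
  have key : ∀ c : ℂ, c * conj c = 1 →
      0 ≤ ((4 * κ : ℝ) : ℂ) * q + (c - conj c) * ((μ - conj μ) * q) := by
    intro c hc
    set y : ι ⊕ ι → ℂ := Sum.elim x (c • x) with hydef
    have h0 := dotProduct_map_ofReal_mulVec_nonneg hB y
    have hmap : (Matrix.fromBlocks ((2 * κ) • S) K Kᵀ ((2 * κ) • S)).map ((↑) : ℝ → ℂ)
        = Matrix.fromBlocks (((2 * κ : ℝ) : ℂ) • S.map ((↑) : ℝ → ℂ)) (K.map ((↑) : ℝ → ℂ))
          (Kᵀ.map ((↑) : ℝ → ℂ)) (((2 * κ : ℝ) : ℂ) • S.map ((↑) : ℝ → ℂ)) := by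
      rw [Matrix.fromBlocks_map]
      congr 1 <;> ext a b <;> simp
    have hstar : star y = Sum.elim (star x) (conj c • star x) := by
      funext j
      rcases j with i | i
      · simp [hydef]
      · simp [hydef]
    rw [hmap, hydef, Matrix.fromBlocks_mulVec, hstar, sumElim_dotProduct_sumElim] at h0
    simp only [Sum.elim_comp_inl, Sum.elim_comp_inr, dotProduct_add, Matrix.smul_mulVec,
      Matrix.mulVec_smul, dotProduct_smul, smul_dotProduct, smul_eq_mul, hKx, hKTx, ← hqdef] at h0
    have hc' : conj c * c = 1 := by rw [mul_comm]; exact hc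
    convert h0 using 1
    push_cast
    linear_combination (-(2 * (κ : ℂ) * q)) * hc'
  have hqC : q = (q.re : ℂ) := Complex.ext (by simp) (by simp [← hqim])
  have hμμ : μ - conj μ = 2 * (μ.im : ℂ) * Complex.I := by
    refine Complex.ext ?_ ?_
    · simp
    · simp; ring
  -- c = i : Im μ ≤ κ
  have hI : Complex.I * conj Complex.I = 1 := by simp
  have h1 := key Complex.I hI
  have hcI : Complex.I - conj Complex.I = 2 * Complex.I := by
    rw [Complex.conj_I]; ring
  rw [hcI, hμμ, hqC] at h1
  have h1' : (0 : ℂ) ≤ (((4 * κ - 4 * μ.im) * q.re : ℝ) : ℂ) := by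
    have : ((4 * κ : ℝ) : ℂ) * (q.re : ℂ) + 2 * Complex.I * (2 * (μ.im : ℂ) * Complex.I * (q.re : ℂ))
        = (((4 * κ - 4 * μ.im) * q.re : ℝ) : ℂ) := by
      push_cast
      linear_combination (4 * (μ.im : ℂ) * (q.re : ℂ)) * Complex.I_mul_I
    rw [this] at h1
    exact h1
  have hA := Complex.zero_le_real.1 h1'
  -- c = −i : −Im μ ≤ κ
  have hI' : (-Complex.I) * conj (-Complex.I) = 1 := by simp
  have h2 := key (-Complex.I) hI'
  have hcI' : -Complex.I - conj (-Complex.I) = -(2 * Complex.I) := by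
    rw [map_neg, Complex.conj_I]; ring
  rw [hcI', hμμ, hqC] at h2
  have h2' : (0 : ℂ) ≤ (((4 * κ + 4 * μ.im) * q.re : ℝ) : ℂ) := by
    have : ((4 * κ : ℝ) : ℂ) * (q.re : ℂ) + -(2 * Complex.I) * (2 * (μ.im : ℂ) * Complex.I * (q.re : ℂ))
        = (((4 * κ + 4 * μ.im) * q.re : ℝ) : ℂ) := by
      push_cast
      linear_combination (-(4 * (μ.im : ℂ) * (q.re : ℂ))) * Complex.I_mul_I
    rw [this] at h2
    exact h2
  have hB' := Complex.zero_le_real.1 h2'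
  rw [abs_le]
  constructor
  · nlinarith [hqre]
  · nlinarith [hqre]

/-- **The COMPLEX mode equation.** For real `d` and complex `ν`: if `z² + d z + ν = 0`, `d > 0` and
`d²·Re ν > (Im ν)²`, then `Re z < 0` (Routh–Hurwitz with a complex constant term: writing `z = p + iq`,
`q(2p + d) = −Im ν` and `p² + dp + Re ν = q² ≤ (Im ν)²/d² < Re ν` when `p ≥ 0` — contradiction).
[cite: HairerNorsettWanner1993, §I.13 Theorem 13.4] -/
theorem quadratic_re_neg_of_region {d : ℝ} {ν z : ℂ} (hd : 0 < d) (hreg : ν.im ^ 2 < d ^ 2 * ν.re)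
    (hz : z ^ 2 + (d : ℂ) * z + ν = 0) : z.re < 0 := by
  have hre := congr_arg Complex.re hz
  have him := congr_arg Complex.im hz
  simp only [Complex.add_re, Complex.add_im, Complex.mul_re, Complex.mul_im, Complex.ofReal_re,
    Complex.ofReal_im, Complex.zero_re, Complex.zero_im, sq, zero_mul, sub_zero, add_zero] at hre him
  -- hre : re² − im² + d re + ν.re = 0 ; him : 2 re im + d im + ν.im = 0
  by_contra hp
  push Not at hp
  set p := z.re
  set q := z.im
  have hνre : 0 < ν.re := by nlinarith [sq_nonneg ν.im]
  have h2pd : 0 < 2 * p + d := by linarith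
  have hq : q * (2 * p + d) = -ν.im := by linear_combination him
  have hq2 : q ^ 2 * (2 * p + d) ^ 2 = ν.im ^ 2 := by
    have : (q * (2 * p + d)) ^ 2 = ν.im ^ 2 := by rw [hq]; ring
    linear_combination this
  have hd2 : d ^ 2 ≤ (2 * p + d) ^ 2 := by nlinarith
  -- q² (2p+d)² = (Im ν)² < d² Re ν ≤ (2p+d)² Re ν ⇒ q² < Re ν
  have hq2lt : q ^ 2 < ν.re := by
    by_contra hcon
    push Not at hcon
    have : (2 * p + d) ^ 2 * ν.re ≤ q ^ 2 * (2 * p + d) ^ 2 := by nlinarith [sq_nonneg (2 * p + d)]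
    nlinarith
  -- but p² + d p = q² − Re ν < 0 with p ≥ 0
  have : p * p + d * p = q * q - ν.re := by linear_combination hre
  nlinarith

/-- **Rate form of the complex mode equation**: `z² + d z + ν = 0`, `d > 2r` and
`(d − 2r)²·(Re ν + r² − d r) > (Im ν)²` ⇒ `Re z < −r` (shift `z = s − r`). [folklore] -/
theorem quadratic_re_lt_neg_of_region {d r : ℝ} {ν z : ℂ} (hd : 0 < d - 2 * r)
    (hreg : ν.im ^ 2 < (d - 2 * r) ^ 2 * (ν.re + r ^ 2 - d * r))
    (hz : z ^ 2 + (d : ℂ) * z + ν = 0) : z.re < -r := by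
  set s : ℂ := z + r with hsdef
  have hs : s ^ 2 + ((d - 2 * r : ℝ) : ℂ) * s + (ν + ((r ^ 2 - d * r : ℝ) : ℂ)) = 0 := by
    rw [hsdef]
    push_cast
    linear_combination hz
  have him' : (ν + ((r ^ 2 - d * r : ℝ) : ℂ)).im = ν.im := by
    simp only [Complex.add_im, Complex.ofReal_im, add_zero]
  have hre' : (ν + ((r ^ 2 - d * r : ℝ) : ℂ)).re = ν.re + (r ^ 2 - d * r) := by
    simp only [Complex.add_re, Complex.ofReal_re]
  have hreg' : (ν + ((r ^ 2 - d * r : ℝ) : ℂ)).im ^ 2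
      < (d - 2 * r) ^ 2 * (ν + ((r ^ 2 - d * r : ℝ) : ℂ)).re := by
    rw [him', hre']
    have : (d - 2 * r) ^ 2 * (ν.re + (r ^ 2 - d * r)) = (d - 2 * r) ^ 2 * (ν.re + r ^ 2 - d * r) := by
      ring
    rw [this]
    exact hreg
  have h := quadratic_re_neg_of_region hd hreg' hs
  have : s.re = z.re + r := by simp [hsdef]
  linarith

end NumRange

end Summit.Ventures.GridStability.Models

end
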